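import Literature.NumberTheory.Congruences.JacobsthalWeakBlockPolynomial
import Mathlib.NumberTheory.Padics.PadicVal.Basic
import Mathlib.Data.Nat.Factorization.Basic
import Mathlib.Data.Nat.Choose.Basic
import Mathlib.Tactic
import HarnessLib

/-!
# Jacobsthal–Kazandzidis at the small primes: `C(ap, bp)/C(a, b) ≡ 1 (mod p^{2+v_p(a)+v_p(b)+v_p(a−b)})` for every odd `p`, and `≡ ε (mod 2^{1+v_2(a)+v_2(b)+v_2(a−b)})` for `p = 2`

Topic `Literature/NumberTheory/Congruences`, namespace `Literature.NumberTheory.Congruences.JacobsthalWeak`; the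
last of the three files `JacobsthalWeakBlockCongruence` → `JacobsthalWeakBlockPolynomial` → this one (the first
holds the sources VERBATIM and the route). Everything here is PROVED (theorems only; no definitions, no named
facts). HONEST FRAMING (cell pub-zeta5, D2 lens): classical `p`-adic congruences for binomial coefficients;
nothing about `ζ(5)` or any irrationality statement.

[Straub2014] Lemma 5.1: «For primes `p` and nonnegative integers `a, b`, `C(ap, bp)/C(a, b) ≡ ε (mod p^q)` (41),
where `q` is the power of `p` dividing `p³ab(a−b)/12` and where `ε = 1`, unless `p = 2` and `(a, b) ≡ (0, 1)`
modulo `2` in which case `ε = −1`.» For `p ≥ 5` this is the tree's `Jacobsthal.exists_ratio` (`q = 3 + v_p(a) +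
v_p(b) + v_p(a−b)`); here the two remaining primes: `q = 2 + …` for `p = 3` (proved uniformly for every odd `p`,
where it is weaker than the tree's) and `q = 1 + …` with the sign for `p = 2`. These are the inputs of the
`p = 3` / `p = 2` paragraphs of the proof of [OsburnSahuStraub2016] Theorem 1.3.

## Main statements (ratio form: `y · C(ap, bp) = x · C(a, b)` with `p ∤ y`; `v = padicValNat`, so `v(0) = 0`)

* `exists_ratio_odd` — `p` odd, all `a, b`: `x ≡ y (mod p^{2 + v_p(a) + v_p(b) + v_p(a−b)})`.
* `exists_ratio_two` — `p = 2`, `b ≤ a`: `x ≡ ε y (mod 2^{1 + v_2(a) + v_2(b) + v_2(a−b)})`, `ε = −1` iff `a` is even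
  and `b` odd. (For `a ≡ b (mod 2)` this is the block polynomial congruence at `x = b`; for `a − b` odd the modulus is
  `2^{1+v_2(b)}` resp. `2^{1+v_2(a)}` and the congruence comes from `E_c(x) ∓ E_c(0)` vanishing at `x = 0` resp.
  `x = −c` together with `E_c(x) − E_c(0) ∈ 2ℤ[x]`.)

References: [Straub2014] Lemma 5.1 (41); [OsburnSahuStraub2016] §2, proof of Theorem 1.3; [Mestrovic2011] §6 (34),
Remark 15. Adapted from the tree's `JacobsthalBinomialCongruence.lean` (denom-engine-d2 g47), whose private
helpers (the exact identity `C(ap, bp) · E_c(0) = C(a, b) · E_c(b)`) are re-proved here.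
-/

noncomputable section

open Polynomial Finset
open scoped Nat

namespace Literature.NumberTheory.Congruences.JacobsthalWeak

section Binomial

variable {p : ℕ} [hp : Fact p.Prime]

omit hp in
/-- `(N + 1)(N + 2)⋯(N + m)` as a product over `Icc 1 m`. [folklore] -/
private theorem ascFactorial_succ_eq_prod (N m : ℕ) :
    (N + 1).ascFactorial m = ∏ i ∈ Icc 1 m, (N + i) := by
  -- adapted from the tree's `Jacobsthal.ascFactorial_succ_eq_prod` (private there)
  induction m with
  | zero => simp
  | succ m ih => rw [Nat.ascFactorial_succ, ih, Finset.prod_Icc_succ_top (by omega)]; ring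

/-- `(mp)! = p^m · m! · ∏_{k<m} (kp + 1)(kp + 2)⋯(kp + p − 1)`. [folklore] -/
private theorem factorial_mul_prime (m : ℕ) :
    (m * p)! = p ^ m * m ! * ∏ k ∈ range m, ∏ i ∈ Icc 1 (p - 1), (k * p + i) := by
  -- adapted from the tree's `Jacobsthal.factorial_mul_prime` (private there)
  have hp1 : 1 ≤ p := hp.out.one_lt.le
  induction m with
  | zero => simp
  | succ n ih =>
    have hblock : (n * p)! * ((∏ i ∈ Icc 1 (p - 1), (n * p + i)) * (n * p + p)) = ((n + 1) * p)! := by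
      have h := Nat.factorial_mul_ascFactorial (n * p) p
      rw [show n * p + p = (n + 1) * p by ring] at h
      rw [← h]
      congr 1
      obtain ⟨k, rfl⟩ : ∃ k, p = k + 1 := ⟨p - 1, by omega⟩
      simp only [Nat.add_sub_cancel]
      rw [ascFactorial_succ_eq_prod, Finset.prod_Icc_succ_top (by omega)]
    rw [← hblock, ih, Finset.prod_range_succ, Nat.factorial_succ, pow_succ]
    ring

omit hp in
/-- `∏_{k<b+c} ∏_i (kp + i) = ∏_{k<b} ∏_i (kp + i) · ∏_{k<c} ∏_i (bp + (kp + i))`. [folklore] -/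
private theorem prod_blocks_add (b c : ℕ) :
    ∏ k ∈ range (b + c), ∏ i ∈ Icc 1 (p - 1), (k * p + i) =
      (∏ k ∈ range b, ∏ i ∈ Icc 1 (p - 1), (k * p + i)) *
        ∏ k ∈ range c, ∏ i ∈ Icc 1 (p - 1), (b * p + (k * p + i)) := by
  -- adapted from the tree's `Jacobsthal.prod_blocks_add` (private there)
  rw [prod_range_add]
  congr 1
  refine prod_congr rfl fun k _ => prod_congr rfl fun i _ => ?_
  ring

/-- A block product contains no multiple of `p`. [folklore] -/
private theorem not_dvd_prod_blocks (c : ℕ) : ¬ p ∣ ∏ k ∈ range c, ∏ i ∈ Icc 1 (p - 1), (k * p + i) := by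
  -- adapted from the tree's `Jacobsthal.not_dvd_prod_blocks` (private there)
  have hp' := hp.out
  intro h
  obtain ⟨k, -, hk⟩ := (Prime.dvd_finsetProd_iff hp'.prime _).mp h
  obtain ⟨i, hi, hki⟩ := (Prime.dvd_finsetProd_iff hp'.prime _).mp hk
  have hi' := mem_Icc.mp hi
  have : p ∣ i := (Nat.dvd_add_right (dvd_mul_left p k)).mp hki
  have := Nat.le_of_dvd (by omega) this
  omega

/-- **The exact identity behind (41)**: for `a = b + c`, `C(ap, bp) · ∏_{0<i<cp, p∤i} i = C(a, b) · ∏_{0<i<cp, p∤i} (bp + i)`.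
[folklore] -/
private theorem choose_mul_prime_mul_prod (b c : ℕ) :
    ((b + c) * p).choose (b * p) * ∏ k ∈ range c, ∏ i ∈ Icc 1 (p - 1), (k * p + i) =
      (b + c).choose b * ∏ k ∈ range c, ∏ i ∈ Icc 1 (p - 1), (b * p + (k * p + i)) := by
  -- adapted from the tree's `Jacobsthal.choose_mul_prime_mul_prod` (private there)
  have hp' := hp.out
  set Qb := ∏ k ∈ range b, ∏ i ∈ Icc 1 (p - 1), (k * p + i) with hQb
  set Qc := ∏ k ∈ range c, ∏ i ∈ Icc 1 (p - 1), (k * p + i) with hQc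
  set R := ∏ k ∈ range c, ∏ i ∈ Icc 1 (p - 1), (b * p + (k * p + i)) with hR
  have h1 := Nat.choose_mul_factorial_mul_factorial (show b * p ≤ (b + c) * p by nlinarith)
  rw [show (b + c) * p - b * p = c * p by rw [Nat.add_mul, Nat.add_sub_cancel_left],
    factorial_mul_prime (p := p) (b + c), factorial_mul_prime (p := p) b, factorial_mul_prime (p := p) c,
    prod_blocks_add, ← hQb, ← hQc, ← hR] at h1
  have h2 := Nat.choose_mul_factorial_mul_factorial (Nat.le_add_right b c)
  rw [Nat.add_sub_cancel_left] at h2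
  have hD : 0 < p ^ (b + c) * b ! * c ! * Qb := by
    have hQ : 0 < Qb := Nat.pos_of_ne_zero fun h =>
      not_dvd_prod_blocks (p := p) b (by rw [← hQb, h]; exact dvd_zero p)
    exact Nat.mul_pos (Nat.mul_pos (Nat.mul_pos (pow_pos hp'.pos _) (Nat.factorial_pos b))
      (Nat.factorial_pos c)) hQ
  refine Nat.eq_of_mul_eq_mul_right hD ?_
  calc ((b + c) * p).choose (b * p) * Qc * (p ^ (b + c) * b ! * c ! * Qb)
      = ((b + c) * p).choose (b * p) * (p ^ b * b ! * Qb) * (p ^ c * c ! * Qc) := by rw [pow_add]; ring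
    _ = p ^ (b + c) * (b + c)! * (Qb * R) := h1
    _ = p ^ (b + c) * ((b + c).choose b * b ! * c !) * (Qb * R) := by rw [h2]
    _ = (b + c).choose b * R * (p ^ (b + c) * b ! * c ! * Qb) := by ring

omit hp in
/-- Casting the shifted block product to `ℤ`: `∏∏ (bp + (kp + i)) = E_c(b)`. [folklore] -/
private theorem cast_prod_shift (b c : ℕ) :
    ((∏ k ∈ range c, ∏ i ∈ Icc 1 (p - 1), (b * p + (k * p + i)) : ℕ) : ℤ) =
      (∏ k ∈ range c, ∏ i ∈ Icc 1 (p - 1), (C (p : ℤ) * X + C ((k * p + i : ℕ) : ℤ))).eval (b : ℤ) := by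
  rw [Nat.cast_prod, eval_prod]
  refine prod_congr rfl fun k _ => ?_
  rw [Nat.cast_prod, eval_prod]
  refine prod_congr rfl fun i _ => ?_
  simp only [eval_add, eval_mul, eval_C, eval_X]
  push_cast
  ring

omit hp in
/-- Casting the block product to `ℤ`: `∏∏ (kp + i) = E_c(0)` as a product of casts. [folklore] -/
private theorem cast_prod_blocks (c : ℕ) :
    ((∏ k ∈ range c, ∏ i ∈ Icc 1 (p - 1), (k * p + i) : ℕ) : ℤ) =
      ∏ k ∈ range c, ∏ i ∈ Icc 1 (p - 1), ((k * p + i : ℕ) : ℤ) := by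
  rw [Nat.cast_prod]
  exact prod_congr rfl fun k _ => Nat.cast_prod _ _

/-- **(41) for every odd prime, unit-ratio form.** For an odd prime `p` and all `a, b`: there are natural numbers
`x, y` with `p ∤ y`, `y · C(ap, bp) = x · C(a, b)` and `x ≡ y (mod p^{2 + v_p(a) + v_p(b) + v_p(a−b)})` — «`C(ap,bp)/C(a,b)
≡ 1 (mod p^q)`, `q` the power of `p` dividing `p³ab(a−b)/12`» at `p = 3` (and one power short of the tree's
`Jacobsthal.exists_ratio` for `p ≥ 5`). Here `x = E_{a−b}(b)`, `y = E_{a−b}(0)`; for `b > a` both binomial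
coefficients vanish. [cite: Straub2014, Lemma 5.1 (41)] [cite: OsburnSahuStraub2016, §2 (proof of Theorem 1.3, the case p = 3)] -/
theorem exists_ratio_odd (hp2 : p ≠ 2) (a b : ℕ) :
    ∃ x y : ℕ, ¬ p ∣ y ∧ y * (a * p).choose (b * p) = x * a.choose b ∧
      x ≡ y [MOD p ^ (2 + padicValNat p a + padicValNat p b + padicValNat p (a - b))] := by
  -- adapted from the tree's `Jacobsthal.exists_ratio` (p ≥ 5, exponent 3 + …)
  have hp' := hp.out
  rcases Nat.lt_or_ge a b with hab | hab
  · refine ⟨1, 1, fun h => hp'.one_lt.ne' (Nat.eq_one_of_dvd_one h), ?_, Nat.ModEq.refl 1⟩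
    rw [Nat.choose_eq_zero_of_lt hab, Nat.choose_eq_zero_of_lt ((Nat.mul_lt_mul_right hp'.pos).mpr hab)]
  obtain ⟨c, rfl⟩ := Nat.exists_eq_add_of_le hab
  rw [Nat.add_sub_cancel_left]
  refine ⟨∏ k ∈ range c, ∏ i ∈ Icc 1 (p - 1), (b * p + (k * p + i)),
    ∏ k ∈ range c, ∏ i ∈ Icc 1 (p - 1), (k * p + i), not_dvd_prod_blocks (p := p) c, ?_, ?_⟩
  · rw [mul_comm, choose_mul_prime_mul_prod (p := p) b c, mul_comm]
  obtain ⟨H, hH⟩ := exists_blocks_eq_odd (p := p) hp2 c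
  have hev := congrArg (fun P : ℤ[X] => P.eval (b : ℤ)) hH
  simp only [eval_add, eval_mul, eval_C, eval_X] at hev
  have hb : (p : ℤ) ^ padicValNat p b ∣ (b : ℤ) := by
    exact_mod_cast (pow_padicValNat_dvd (p := p) (n := b))
  have hbc : (p : ℤ) ^ padicValNat p (b + c) ∣ ((b : ℤ) + c) := by
    exact_mod_cast (pow_padicValNat_dvd (p := p) (n := b + c))
  have hS : (p : ℤ) ^ (padicValNat p c + 2) * (p : ℤ) ^ padicValNat p b * (p : ℤ) ^ padicValNat p (b + c) ∣
      (p : ℤ) ^ (padicValNat p c + 2) * b * (((b : ℤ) + c) * H.eval (b : ℤ)) :=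
    mul_dvd_mul (mul_dvd_mul_left _ hb) (hbc.mul_right _)
  rw [Nat.modEq_iff_dvd, cast_prod_shift, hev, cast_prod_blocks, Nat.cast_pow, ← sub_sub, sub_self, zero_sub,
    dvd_neg, show 2 + padicValNat p (b + c) + padicValNat p b + padicValNat p c =
      (padicValNat p c + 2) + padicValNat p b + padicValNat p (b + c) by ring, pow_add, pow_add,
    mul_assoc ((p : ℤ) ^ (padicValNat p c + 2) * (b : ℤ)) ((b : ℤ) + c) (H.eval (b : ℤ))]
  exact hS

end Binomial

/-! ### The prime `2`, with its sign -/

section Two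

/-- If `X * G` is coefficientwise divisible by `n`, so is `G`. [folklore] -/
private theorem C_dvd_of_C_dvd_X_mul' (n : ℤ) (G : ℤ[X]) (h : C n ∣ X * G) : C n ∣ G := by
  rw [C_dvd_iff_dvd_coeff] at h ⊢
  intro i
  have := h (i + 1)
  rwa [coeff_X_mul] at this

/-- **(41) at `p = 2`, unit-ratio form with the sign.** For `b ≤ a` there are natural numbers `x, y` with `y` odd,
`y · C(2a, 2b) = x · C(a, b)` and `x ≡ ε y (mod 2^{1 + v_2(a) + v_2(b) + v_2(a−b)})`, where «`ε = 1`, unless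
`(a, b) ≡ (0, 1)` modulo `2` in which case `ε = −1`» — i.e. «`q` the power of `2` dividing `2³ab(a−b)/12`».
Here `x = E_{a−b}(b) = ∏_{k<a−b} (2b + 2k + 1)`, `y = E_{a−b}(0)`. [cite: Straub2014, Lemma 5.1 (41) (the case p = 2)]
[cite: OsburnSahuStraub2016, §2 (proof of Theorem 1.3, the case p = 2)] -/
theorem exists_ratio_two {a b : ℕ} (hab : b ≤ a) :
    ∃ x y : ℕ, ¬ 2 ∣ y ∧ y * (a * 2).choose (b * 2) = x * a.choose b ∧
      (x : ℤ) ≡ (if Even a ∧ ¬ Even b then -(y : ℤ) else y)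
        [ZMOD 2 ^ (1 + padicValNat 2 a + padicValNat 2 b + padicValNat 2 (a - b))] := by
  obtain ⟨c, rfl⟩ := Nat.exists_eq_add_of_le hab
  rw [Nat.add_sub_cancel_left]
  set E : ℤ[X] := ∏ k ∈ range c, ∏ i ∈ Icc 1 (2 - 1), (C (2 : ℤ) * X + C ((k * 2 + i : ℕ) : ℤ)) with hE
  set Q : ℤ := ∏ k ∈ range c, ∏ i ∈ Icc 1 (2 - 1), ((k * 2 + i : ℕ) : ℤ) with hQ
  refine ⟨∏ k ∈ range c, ∏ i ∈ Icc 1 (2 - 1), (b * 2 + (k * 2 + i)),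
    ∏ k ∈ range c, ∏ i ∈ Icc 1 (2 - 1), (k * 2 + i), not_dvd_prod_blocks (p := 2) c, ?_, ?_⟩
  · rw [mul_comm, choose_mul_prime_mul_prod (p := 2) b c, mul_comm]
  have hx : ((∏ k ∈ range c, ∏ i ∈ Icc 1 (2 - 1), (b * 2 + (k * 2 + i)) : ℕ) : ℤ) = E.eval (b : ℤ) := by
    rw [hE]; exact cast_prod_shift (p := 2) b c
  have hy : ((∏ k ∈ range c, ∏ i ∈ Icc 1 (2 - 1), (k * 2 + i) : ℕ) : ℤ) = Q := by
    rw [hQ]; exact cast_prod_blocks (p := 2) c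
  have hQ0 : E.eval 0 = Q := by
    rw [hE, hQ]; exact eval_zero_blocks (p := 2) c
  rw [hx, hy]
  have h2b : (2 : ℤ) ^ padicValNat 2 b ∣ (b : ℤ) := by
    exact_mod_cast (pow_padicValNat_dvd (p := 2) (n := b))
  have h2a : (2 : ℤ) ^ padicValNat 2 (b + c) ∣ ((b : ℤ) + c) := by
    exact_mod_cast (pow_padicValNat_dvd (p := 2) (n := b + c))
  rcases Nat.even_or_odd c with hce | hco
  · -- `c` even: `a ≡ b (mod 2)`, `ε = 1`, the block polynomial congruence at `x = b`
    have hε : ¬ (Even (b + c) ∧ ¬ Even b) := by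
      rintro ⟨h1, h2⟩
      exact h2 ((Nat.even_add.mp h1).mpr hce)
    rw [if_neg hε, Int.modEq_iff_dvd]
    obtain ⟨H, hH⟩ := exists_blocks_eq_two hce
    have hev := congrArg (fun P : ℤ[X] => P.eval (b : ℤ)) hH
    simp only [eval_add, eval_mul, eval_C, eval_X] at hev
    have hev' : E.eval (b : ℤ) - Q = (2 : ℤ) ^ (padicValNat 2 c + 1) * b * ((b + c) * H.eval (b : ℤ)) := by
      have h' : E.eval (b : ℤ) = Q + (2 : ℤ) ^ (padicValNat 2 c + 1) * b * (b + c) * H.eval (b : ℤ) := by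
        have := hev; simpa [hE, hQ] using this
      rw [h']; ring
    rw [← neg_sub, dvd_neg, hev', show 1 + padicValNat 2 (b + c) + padicValNat 2 b + padicValNat 2 c =
      (padicValNat 2 c + 1) + padicValNat 2 b + padicValNat 2 (b + c) by ring, pow_add, pow_add]
    exact mul_dvd_mul (mul_dvd_mul_left _ h2b) (h2a.mul_right _)
  · -- `c` odd: `E − E(0) = 2 G` with `G(0) = 0`, and `E(−c) = −E(0)`
    have hvc : padicValNat 2 c = 0 := padicValNat.eq_zero_of_not_dvd (by simpa using hco.not_two_dvd_nat)
    obtain ⟨G, hG⟩ := C_dvd_blocks_sub_C_eval_zero (p := 2) c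
    have hG' : E - C Q = C (2 : ℤ) * G := by simpa [hE, hQ] using hG
    rcases Nat.even_or_odd b with hbe | hbo
    · -- `b` even, `a` odd: `ε = 1`, modulus `2^{1 + v_2(b)}`; `x − y = E(b) − E(0) = 2 b G₁(b)`
      have hao : ¬ Even (b + c) := by
        rw [Nat.not_even_iff_odd]; exact hbe.add_odd hco
      have hva : padicValNat 2 (b + c) = 0 :=
        padicValNat.eq_zero_of_not_dvd (by simpa using (Nat.not_even_iff_odd.mp hao).not_two_dvd_nat)
      rw [if_neg (fun h => hao h.1), hva, hvc, add_zero, Int.modEq_iff_dvd]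
      -- `G(0) = 0`, so `G = X G₁`
      have hG0 : G.eval 0 = 0 := by
        have h := congrArg (fun P : ℤ[X] => P.eval 0) hG'
        simp only [eval_sub, eval_C, eval_mul, hQ0, sub_self] at h
        linarith
      obtain ⟨G₁, hG₁⟩ : X ∣ G := by rw [X_dvd_iff, coeff_zero_eq_eval_zero, hG0]
      have hxy : E.eval (b : ℤ) - Q = 2 * b * G₁.eval (b : ℤ) := by
        have h := congrArg (fun P : ℤ[X] => P.eval (b : ℤ)) hG'
        simp only [eval_sub, eval_C, eval_mul, hG₁, eval_X] at h
        linarith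
      rw [← neg_sub, dvd_neg, hxy, show 1 + 0 + padicValNat 2 b = 1 + padicValNat 2 b by ring, pow_add,
        pow_one]
      exact (mul_dvd_mul_left 2 h2b).mul_right _
    · -- `b` odd, `a` even: `ε = −1`, modulus `2^{1 + v_2(a)}`; `x + y = E(b) + E(0) = 2 a F₁(b)`
      have hae : Even (b + c) := hbo.add_odd hco
      have hvb : padicValNat 2 b = 0 := padicValNat.eq_zero_of_not_dvd (by simpa using hbo.not_two_dvd_nat)
      rw [if_pos ⟨hae, Nat.not_even_iff_odd.mpr hbo⟩, hvb, hvc, add_zero, add_zero, Int.modEq_iff_dvd,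
        show -Q - E.eval (b : ℤ) = -(Q + E.eval (b : ℤ)) by ring, dvd_neg]
      -- `F = G + Q` has the root `−c`
      have hEc : E.eval (-(c : ℤ)) = -Q := by
        have h := eval_neg_blocks_eq (p := 2) c
        rw [show (2 - 1) * c = c by omega, hco.neg_one_pow] at h
        have h' : E.eval (-(c : ℤ)) = -1 * Q := by rw [hE, hQ]; exact_mod_cast h
        rw [h', neg_one_mul]
      have hF : (G + C Q).IsRoot (-(c : ℤ)) := by
        have h := congrArg (fun P : ℤ[X] => P.eval (-(c : ℤ))) hG'
        simp only [eval_sub, eval_C, eval_mul, hEc] at h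
        rw [IsRoot, eval_add, eval_C]
        linarith
      obtain ⟨F₁, hF₁⟩ := dvd_iff_isRoot.mpr hF
      rw [C_neg, sub_neg_eq_add] at hF₁
      have hxy : (Q : ℤ) + E.eval (b : ℤ) = 2 * ((b : ℤ) + c) * F₁.eval (b : ℤ) := by
        have h := congrArg (fun P : ℤ[X] => P.eval (b : ℤ)) hG'
        have h2 := congrArg (fun P : ℤ[X] => P.eval (b : ℤ)) hF₁
        simp only [eval_sub, eval_C, eval_mul, eval_add, eval_X] at h h2
        linarith
      rw [hxy, pow_add, pow_one]
      exact (mul_dvd_mul_left 2 h2a).mul_right _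

end Two

end Literature.NumberTheory.Congruences.JacobsthalWeak

end
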